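import Literature.NumberTheory.ComplexMultiplication.CMBalancedPolarisedStructureOfType
import Literature.NumberTheory.ComplexMultiplication.CMBalancedDivisorFiniteExtension
import Literature.NumberTheory.ComplexMultiplication.MainTheoremCMLevelQMultiplication
import Literature.NumberTheory.ComplexMultiplication.CMStructureUniformized
import Literature.AlgebraicGeometry.ComplexMultiplication.CMTypeRealisationIsogenyTransport
import Literature.AlgebraicGeometry.Motives.AbelianVarietyWeilPairingRosatiTransport
import Literature.AlgebraicGeometry.Motives.AbelianVarietyWeilPairingRadicalComposite
import Literature.AlgebraicGeometry.Motives.AbelianVarietyWeilPairingPullbackBaseChange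
import Literature.AlgebraicGeometry.Motives.AbelianVarietyWeilPairingDivisorClass
import Literature.AlgebraicGeometry.Motives.AbelianVarietyBaseChangeTowerFst
import HarnessLib

/-!
# Row II-1-S5b from row II-1-S5b″: the `K`-balanced non-degenerate divisor over a finite extension, from ONE balanced
# polarised structure of the type over a number field (Shimura 1998 §6.2 Thm. 4 (3), §12.4 Prop. 26, §4.1 Prop. 10;
# transport by §7.4 Prop. 15 and Mumford §20 (3))

Topic `Literature/NumberTheory/ComplexMultiplication`, namespace `Literature.NumberTheory.ComplexMultiplication`.
THEOREMS ONLY (no definition, no instance, no named fact; net Literature debt 0; the assembly retires the named fact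
`exists_balancedDivisor_finiteExtension` (row II-1-S5b, B-typ02) in favour of `exists_balancedPolarisedStructure_numberField`
(row II-1-S5b″, B-typ02): cell `hodgecm-mathlib` (D-0151), h21 line `b2-main-theorem-cm`, director ruling «S5b OPTION R»
2026-08-28T06:10:16Z).

THE MATHEMATICS (B-typ02/A-p03 census 2026-08-28T06:09:30Z).  Let `(A₀, ι₀)` be of type `(K, Φ)` over the number field
`L ⊂ ℂ`, and let `(B₀, ι_B, Θ₀)` over the number field `k ⊂ ℂ` be the balanced polarised structure of type `(K, Φ)` of
S5b″ (`Θ₀` ample, the complex Weil pairings of `Θ₀` Rosati-balanced for `ι_B`).  Over a common finite extension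
`L′ ⊂ ℂ` of `L` and `k` over which all homomorphisms between the two structures are rational ([Shimura1998] §1.2 / row II-1-S9
— the hypothesis `hpair` of §2, supplied by `…AbelianVarietyHomRationalCommonFieldPair`), the two complexifications are
uniformised as `ℂ^Φ/D(𝔞)`, `ℂ^Φ/D(𝔟)` ([Shimura1998] §6.1, tree `exists_cmTypeUniformization`), and after re-indexing `𝔞` to
`b𝔞 = 𝔮𝔟 ⊆ 𝔟` (`b ∈ 𝔞⁻¹𝔟`, §7.4 Prop. 15) the identity of `ℂ^Φ` is an `𝔬_K`-linear ISOGENY `λ : A₀ ⊗ L′ → B₀ ⊗ L′`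
RATIONAL OVER `L′` (tree `exists_qMultiplication`, `isIsogeny_of_map_baseChange_r_eq`, B-p10).  The divisor is
`X := λ^*(Θ₀ ⊗ L′)` on `A₀ ⊗ L′`: its complexification is Rosati-balanced because `λ` is `𝔬_K`-linear (Mumford §20 (3)
`ē^{f^*Θ}(P,Q) = ē^Θ(fP,fQ)`, tree `weilPairingLevel_rosatiBalanced_pullback` / `weilPairingLevel_baseChange_map`, and the
tower isomorphism `(B₀ ⊗ L′) ⊗ ℂ ≅ B₀ ⊗ ℂ` for the comparison with S5b″'s clause), and non-degenerate with bounded radicals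
because it is AMPLE (pull-back of an ample divisor along affine morphisms; Lang VII §2 Prop. 4, tree
`exists_radical_pow_eq_one_of_isAmple`, A-p17).

## References
* [Shimura1998] G. Shimura, *Abelian Varieties with Complex Multiplication and Modular Functions* (1998): §6.2 Thm. 4 (3)
  (p. 44), §4.1 Prop. 10 (p. 23), §7.4 Prop. 15 (p. 53), §12.4 Prop. 26, §18.4 (18.4b) (≈ p. 123), §18.6 proof of Thm. 18.6 (p. 127).
* [MumfordAV1970] D. Mumford, *Abelian Varieties* (1970), §20 (3) (p. 186), §23 (p. 208), §6 Application 1 (p. 60).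
* [Lang1983AbelianVarieties] S. Lang, *Abelian Varieties*, Ch. VII §2 Prop. 4.
-/

set_option autoImplicit false

noncomputable section

open scoped nonZeroDivisors NumberField
open CategoryTheory CategoryTheory.Limits NumberField AlgebraicGeometry FractionalIdeal

namespace Literature.NumberTheory.ComplexMultiplication

open Literature.AlgebraicGeometry.Motives Literature.AlgebraicGeometry.Motives.AbelianVariety

/-! ## §1 An `𝔬_K`-linear isogeny between two models of the same type over a common field of rationality -/

section Isogeny

variable {K : Type} [Field K] [NumberField K] {Φ : CMType K}
  {k : Type} [Field k] [Algebra k ℂ] {A B : AbelianVariety k} {ιA : 𝓞 K →+* End A} {ιB : 𝓞 K →+* End B}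

/-- **Re-indexing bookkeeping** ([Shimura1998] §7.4 Prop. 15: «if `γ ∈ 𝔞⁻¹𝔟`, `S(γ)D(𝔞) ⊂ D(𝔟)`»): for fractional ideals
`𝔞, 𝔟` there are `b ∈ K^×` and an INTEGRAL ideal `𝔮` with `𝔮𝔟 = b𝔞` (take `b ∈ 𝔞⁻¹𝔟 ∖ 0`, `𝔮 = b𝔞𝔟⁻¹ ⊆ 𝔬_K`).
[cite: Shimura1998, §7.4 Prop. 15 (p. 53)] -/
theorem exists_ne_zero_ideal_mul_eq_spanSingleton_mul (𝔞 𝔟 : (FractionalIdeal (𝓞 K)⁰ K)ˣ) :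
    ∃ (b : K) (_ : b ≠ 0) (𝔮 : Ideal (𝓞 K)),
      (𝔮 : FractionalIdeal (𝓞 K)⁰ K) * (𝔟 : FractionalIdeal (𝓞 K)⁰ K) =
        spanSingleton (𝓞 K)⁰ b * (𝔞 : FractionalIdeal (𝓞 K)⁰ K) := by
  have h𝔞0 : (𝔞 : FractionalIdeal (𝓞 K)⁰ K) ≠ 0 := 𝔞.ne_zero
  have h𝔟0 : (𝔟 : FractionalIdeal (𝓞 K)⁰ K) ≠ 0 := 𝔟.ne_zero
  have hJ0 : ((𝔞 : FractionalIdeal (𝓞 K)⁰ K)⁻¹ * 𝔟 : FractionalIdeal (𝓞 K)⁰ K) ≠ 0 :=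
    mul_ne_zero (inv_ne_zero h𝔞0) h𝔟0
  have hJ0' : (((𝔞 : FractionalIdeal (𝓞 K)⁰ K)⁻¹ * 𝔟 : FractionalIdeal (𝓞 K)⁰ K) : Submodule (𝓞 K) K) ≠ ⊥ := by
    rwa [Ne, FractionalIdeal.coeToSubmodule_eq_bot]
  obtain ⟨b, hb, hb0⟩ := Submodule.exists_mem_ne_zero_of_ne_bot hJ0'
  rw [FractionalIdeal.mem_coe] at hb
  -- `𝔮 := b𝔞𝔟⁻¹` is integral
  have hle : spanSingleton (𝓞 K)⁰ b * (𝔞 : FractionalIdeal (𝓞 K)⁰ K) * (𝔟 : FractionalIdeal (𝓞 K)⁰ K)⁻¹ ≤ 1 := by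
    have h1 : spanSingleton (𝓞 K)⁰ b ≤ (𝔞 : FractionalIdeal (𝓞 K)⁰ K)⁻¹ * 𝔟 :=
      (spanSingleton_le_iff_mem).2 hb
    calc spanSingleton (𝓞 K)⁰ b * (𝔞 : FractionalIdeal (𝓞 K)⁰ K) * (𝔟 : FractionalIdeal (𝓞 K)⁰ K)⁻¹
        ≤ ((𝔞 : FractionalIdeal (𝓞 K)⁰ K)⁻¹ * 𝔟) * 𝔞 * (𝔟 : FractionalIdeal (𝓞 K)⁰ K)⁻¹ :=
          mul_le_mul' (mul_le_mul' h1 le_rfl) le_rfl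
      _ = 1 := by
          rw [mul_comm ((𝔞 : FractionalIdeal (𝓞 K)⁰ K)⁻¹ * 𝔟) (𝔞 : FractionalIdeal (𝓞 K)⁰ K), ← mul_assoc,
            mul_inv_cancel₀ h𝔞0, one_mul, mul_inv_cancel₀ h𝔟0]
  obtain ⟨𝔮, h𝔮⟩ := (FractionalIdeal.le_one_iff_exists_coeIdeal).1 hle
  refine ⟨b, hb0, 𝔮, ?_⟩
  rw [h𝔮, mul_assoc, inv_mul_cancel₀ h𝔟0, mul_one]

/-- **An `𝔬_K`-linear isogeny between two structures of type `(K, Φ)` over a common field of rationality `k ⊂ ℂ`**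
([Shimura1998] §7.4 Prop. 15 + proof of Thm. 18.6 p. 127 «the identity map of `ℂⁿ` defines a homomorphism `λ` of `A` ONTO `A_i`», in the
tree's currency: `exists_qMultiplication` / `isIsogeny_of_map_baseChange_r_eq`, B-p10): if `(A, ιA)`, `(B, ιB)` over `k`
are both of type `(K, Φ)` and every `ℂ`-homomorphism between their complexifications is rational over `k` (both ways),
there is an ISOGENY `λ : A ⟶ B` over `k` with `ιA(a) ≫ λ = λ ≫ ιB(a)`.
[cite: Shimura1998, §7.4 Prop. 15 (p. 53); §18.6 proof of Thm. 18.6 p. 127 (held text chunk p0166 L5–12)] -/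
theorem exists_isIsogeny_comm_of_isCMTypeRealisationOver (hA : IsCMTypeRealisationOver Φ A ιA)
    (hB : IsCMTypeRealisationOver Φ B ιB)
    (hAB : Function.Surjective (Hom.baseChange ℂ : (A ⟶ B) → (A.baseChange ℂ ⟶ B.baseChange ℂ)))
    (hBA : Function.Surjective (Hom.baseChange ℂ : (B ⟶ A) → (B.baseChange ℂ ⟶ A.baseChange ℂ))) :
    ∃ lam : A ⟶ B, IsIsogeny lam ∧ ∀ a : 𝓞 K, (ιA a : A ⟶ A) ≫ lam = lam ≫ (ιB a : B ⟶ B) := by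
  obtain ⟨𝔞, ⟨ξ⟩⟩ := hA.exists_cmTypeUniformization
  obtain ⟨𝔟, ⟨η⟩⟩ := hB.exists_cmTypeUniformization
  obtain ⟨b, hb0, 𝔮, h𝔮⟩ := exists_ne_zero_ideal_mul_eq_spanSingleton_mul 𝔞 𝔟
  -- re-index `ξ` to the type `b𝔞 = 𝔮𝔟`
  let 𝔞' : (FractionalIdeal (𝓞 K)⁰ K)ˣ := Units.mk0 (spanSingleton (𝓞 K)⁰ b * (𝔞 : FractionalIdeal (𝓞 K)⁰ K))
    (mul_ne_zero (spanSingleton_eq_zero_iff.not.2 hb0) 𝔞.ne_zero)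
  obtain ⟨ξ', -, -⟩ := ξ.exists_reindex (𝔟 := 𝔞') hb0 rfl
  have h𝔮' : (𝔮 : FractionalIdeal (𝓞 K)⁰ K) * (𝔟 : FractionalIdeal (𝓞 K)⁰ K) = 𝔞' := h𝔮
  obtain ⟨lam, hcomm, hlam, -⟩ := CMTypeUniformization.exists_qMultiplication ξ' η hAB 𝔮 h𝔮'
  exact ⟨lam, CMTypeUniformization.isIsogeny_of_map_baseChange_r_eq ξ' η hBA 𝔮 h𝔮' hlam, hcomm⟩

end Isogeny


/-! ## §2 The core transport: from a balanced polarised model over `k` to the divisor on `A₀ ⊗ L′` -/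

section Core

variable {K : Type} [Field K] [NumberField K] [IsCMField K] {Φ : CMType K}
  {L : Type} [Field L] [NumberField L] [Algebra L ℂ] {A₀ : AbelianVariety L} {ι₀ : 𝓞 K →+* End A₀}
  {k : Type} [Field k] [NumberField k] [Algebra k ℂ] {B₀ : AbelianVariety k} {ιB : 𝓞 K →+* End B₀}

omit [NumberField L] [NumberField k] in
/-- **The transport** ([Shimura1998] §7.4 Prop. 15 + §18.6 proof of Thm. 18.6 p. 127 for the isogeny `λ`; Mumford §20 (3) / §23 for the
Rosati-balancedness of `λ^*Θ`; Lang VII §2 Prop. 4 for the radicals of an ample divisor): let `(A₀, ι₀)/L` and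
`(B₀, ι_B)/k` be of type `(K, Φ)`, `Θ₀` an ample divisor on `B₀` whose complex Weil pairings are Rosati-balanced for
`ι_B` (the clause of S5b″), and `L′ ⊂ ℂ` a finite extension of `L` receiving `k` over which every `ℂ`-homomorphism
between `A₀ ⊗ L′` and `B₀ ⊗ L′` is rational (both ways).  Then for the `𝔬_K`-linear isogeny `λ : A₀ ⊗ L′ → B₀ ⊗ L′`
(§1) the divisor `X := λ^*(pr^*Θ₀)` on `A₀ ⊗ L′` has the two properties (bal), (nd) of
`exists_balancedDivisor_finiteExtension`, VERBATIM. [cite: Shimura1998, §7.4 Prop. 15 p. 53; §18.4 (18.4b) (≈ p. 123); §18.6 proof of Thm. 18.6 p. 127]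
[cite: MumfordAV1970, §20 (3) (p. 186), §23 (p. 208), §6 Application 1 (p. 60)] [cite: Lang1983AbelianVarieties, Ch. VII §2 Prop. 4] -/
theorem exists_balancedDivisor_of_polarisedModel (hA₀ : IsCMTypeRealisationOver Φ A₀ ι₀)
    (hB₀ : IsCMTypeRealisationOver Φ B₀ ιB) (Θ₀ : CartierDivisor B₀.X.left) (hΘ₀ : Θ₀.IsAmple)
    (hbal₀ : ∀ (πB : (B₀.baseChange ℂ).X.left ⟶ B₀.X.left)
      (_hπB : πB = pullback.fst B₀.X.hom (bcSpec k ℂ)) [IsDominant πB]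
      (ℓ : ℕ), 1 < ℓ →
        ∀ [_hdom : ∀ j : ℕ, IsDominant (Hom.toSchemeHom (((ℓ ^ j : ℕ) : ℤ) • 𝟙 (B₀.baseChange ℂ)))]
          (j : ℕ) (a : 𝓞 K) (P Q : (B₀.baseChange ℂ).torsionPoints ℂ ((ℓ ^ j : ℕ) : ℤ)),
          (B₀.baseChange ℂ).weilPairingLevel (Θ₀.pullback πB)
              ⟨AlgPoints.map (((B₀.endBaseChange ℂ).comp ιB) a).hom.hom.hom P.1,
                map_mem_torsionPoints (((B₀.endBaseChange ℂ).comp ιB) a) P.2⟩ Q =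
            (B₀.baseChange ℂ).weilPairingLevel (Θ₀.pullback πB) P
              ⟨AlgPoints.map (((B₀.endBaseChange ℂ).comp ιB) (IsCMField.ringOfIntegersComplexConj K a)).hom.hom.hom Q.1,
                map_mem_torsionPoints (((B₀.endBaseChange ℂ).comp ιB) (IsCMField.ringOfIntegersComplexConj K a)) Q.2⟩)
    (L' : IntermediateField L ℂ) [Algebra k ↥L'] [IsScalarTower k ↥L' ℂ]
    (hAB : Function.Surjective (Hom.baseChange ℂ : (A₀.baseChange ↥L' ⟶ B₀.baseChange ↥L') →
      ((A₀.baseChange ↥L').baseChange ℂ ⟶ (B₀.baseChange ↥L').baseChange ℂ)))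
    (hBA : Function.Surjective (Hom.baseChange ℂ : (B₀.baseChange ↥L' ⟶ A₀.baseChange ↥L') →
      ((B₀.baseChange ↥L').baseChange ℂ ⟶ (A₀.baseChange ↥L').baseChange ℂ))) :
    ∃ X : CartierDivisor (A₀.baseChange L').X.left,
      ∀ (πA : ((A₀.baseChange L').baseChange ℂ).X.left ⟶ (A₀.baseChange L').X.left)
        (_hπA : πA = pullback.fst (A₀.baseChange L').X.hom (bcSpec L' ℂ)) [IsDominant πA]
        (ℓ : ℕ), 1 < ℓ →
        ∀ [_hdom : ∀ k : ℕ,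
            IsDominant (Hom.toSchemeHom (((ℓ ^ k : ℕ) : ℤ) • 𝟙 ((A₀.baseChange L').baseChange ℂ)))],
        (∀ (k : ℕ) (a : 𝓞 K) (P Q : ((A₀.baseChange L').baseChange ℂ).torsionPoints ℂ ((ℓ ^ k : ℕ) : ℤ)),
          ((A₀.baseChange L').baseChange ℂ).weilPairingLevel (X.pullback πA)
              ⟨AlgPoints.map ((((A₀.baseChange L').endBaseChange ℂ).comp
                  ((A₀.endBaseChange L').comp ι₀)) a).hom.hom.hom P.1,
                map_mem_torsionPoints ((((A₀.baseChange L').endBaseChange ℂ).comp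
                  ((A₀.endBaseChange L').comp ι₀)) a) P.2⟩ Q =
            ((A₀.baseChange L').baseChange ℂ).weilPairingLevel (X.pullback πA) P
              ⟨AlgPoints.map ((((A₀.baseChange L').endBaseChange ℂ).comp
                  ((A₀.endBaseChange L').comp ι₀)) (IsCMField.ringOfIntegersComplexConj K a)).hom.hom.hom Q.1,
                map_mem_torsionPoints ((((A₀.baseChange L').endBaseChange ℂ).comp
                  ((A₀.endBaseChange L').comp ι₀)) (IsCMField.ringOfIntegersComplexConj K a)) Q.2⟩) ∧
        ∃ c : ℕ, ∀ (k : ℕ) (Q : ((A₀.baseChange L').baseChange ℂ).torsionPoints ℂ ((ℓ ^ k : ℕ) : ℤ)),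
          (∀ P : ((A₀.baseChange L').baseChange ℂ).torsionPoints ℂ ((ℓ ^ k : ℕ) : ℤ),
              ((A₀.baseChange L').baseChange ℂ).weilPairingLevel (X.pullback πA) P Q = 1) →
            (Q : ((A₀.baseChange L').baseChange ℂ).Points ℂ) ^ (ℓ ^ c) = 1 := by
  -- the two models over `L′` are of type `(K, Φ)`
  have hA₁ : IsCMTypeRealisationOver Φ (A₀.baseChange ↥L') ((A₀.endBaseChange ↥L').comp ι₀) := hA₀.baseChange
  have hB₁ : IsCMTypeRealisationOver Φ (B₀.baseChange ↥L') ((B₀.endBaseChange ↥L').comp ιB) := hB₀.baseChange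
  -- the `𝔬_K`-linear isogeny `λ : A₀ ⊗ L′ → B₀ ⊗ L′`
  obtain ⟨lam, hiso, hcomm⟩ := exists_isIsogeny_comm_of_isCMTypeRealisationOver hA₁ hB₁ hAB hBA
  haveI : IsDominant (Hom.toSchemeHom lam) := hiso.isDominant_toSchemeHom
  haveI : IsDominant (Hom.toSchemeHom (Hom.baseChange ℂ lam)) := hiso.isDominant_toSchemeHom_baseChange ℂ
  -- the projections, pinned by equations
  obtain ⟨prB, hprB⟩ : ∃ f : (B₀.baseChange ↥L').X.left ⟶ B₀.X.left, f = pullback.fst B₀.X.hom (bcSpec k ↥L') :=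
    ⟨_, rfl⟩
  haveI : IsDominant prB := by rw [hprB]; exact isDominant_baseChangeFst (↥L') B₀
  obtain ⟨πB₁, hπB₁⟩ : ∃ f : ((B₀.baseChange ↥L').baseChange ℂ).X.left ⟶ (B₀.baseChange ↥L').X.left,
      f = pullback.fst (B₀.baseChange ↥L').X.hom (bcSpec (↥L') ℂ) := ⟨_, rfl⟩
  haveI : IsDominant πB₁ := by rw [hπB₁]; exact isDominant_baseChangeFst ℂ (B₀.baseChange ↥L')
  obtain ⟨πB, hπB⟩ : ∃ f : (B₀.baseChange ℂ).X.left ⟶ B₀.X.left, f = pullback.fst B₀.X.hom (bcSpec k ℂ) := ⟨_, rfl⟩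
  haveI : IsDominant πB := by rw [hπB]; exact isDominant_baseChangeFst ℂ B₀
  -- the tower isomorphism `e : (B₀ ⊗ L′) ⊗ ℂ ≅ B₀ ⊗ ℂ`
  haveI : IsDominant (Hom.toSchemeHom (baseChangeTowerIso k (↥L') ℂ B₀).hom) :=
    (IsIsogeny.of_iso (baseChangeTowerIso k (↥L') ℂ B₀)).isDominant_toSchemeHom
  -- THE DIVISOR `X := λ^*(pr_B^* Θ₀)` on `A₀ ⊗ L′`
  refine ⟨(Θ₀.pullback prB).pullback (Hom.toSchemeHom lam), ?_⟩
  intro πA hπA _ ℓ hℓ _hdom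
  have hℓ0 : ℓ ≠ 0 := by omega
  -- equivariance of `λ ⊗ ℂ` and of the tower isomorphism
  have hflam : ∀ a : 𝓞 K,
      ((((A₀.baseChange ↥L').endBaseChange ℂ).comp ((A₀.endBaseChange ↥L').comp ι₀)) a :
          (A₀.baseChange ↥L').baseChange ℂ ⟶ (A₀.baseChange ↥L').baseChange ℂ) ≫ Hom.baseChange ℂ lam =
        Hom.baseChange ℂ lam ≫ (((B₀.baseChange ↥L').endBaseChange ℂ).comp ((B₀.endBaseChange ↥L').comp ιB)) a := by
    intro a
    change Hom.baseChange ℂ (Hom.baseChange (↥L') (ι₀ a)) ≫ Hom.baseChange ℂ lam =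
      Hom.baseChange ℂ lam ≫ Hom.baseChange ℂ (Hom.baseChange (↥L') (ιB a))
    rw [← Hom.baseChange_comp, ← Hom.baseChange_comp]
    exact congrArg (Hom.baseChange ℂ) (hcomm a)
  have hfT : ∀ a : 𝓞 K,
      ((((B₀.baseChange ↥L').endBaseChange ℂ).comp ((B₀.endBaseChange ↥L').comp ιB)) a :
          (B₀.baseChange ↥L').baseChange ℂ ⟶ (B₀.baseChange ↥L').baseChange ℂ) ≫
          (baseChangeTowerIso k (↥L') ℂ B₀).hom =
        (baseChangeTowerIso k (↥L') ℂ B₀).hom ≫ ((B₀.endBaseChange ℂ).comp ιB) a := fun a =>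
    Hom.baseChange_baseChange_comp_baseChangeTowerIso_hom (↥L') ℂ (ιB a : B₀ ⟶ B₀)
  -- the tower square: `(B₀ ⊗ L′) ⊗ ℂ → B₀ ⊗ L′ → B₀` is `e ≫ pr`
  have hsq : πB₁ ≫ prB = Hom.toSchemeHom (baseChangeTowerIso k (↥L') ℂ B₀).hom ≫ πB := by
    rw [hπB₁, hprB, hπB]
    exact (toSchemeHom_baseChangeTowerIso_hom_comp_fst k (↥L') ℂ B₀).symm
  -- the complex divisor on `(B₀ ⊗ L′) ⊗ ℂ` is `e^*(Θ₀)_ℂ`, same divisor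
  have hsd₂ : ((Θ₀.pullback prB).pullback πB₁).SameDivisor
      ((Θ₀.pullback πB).pullback (Hom.toSchemeHom (baseChangeTowerIso k (↥L') ℂ B₀).hom)) := by
    haveI : IsDominant (πB₁ ≫ prB) := inferInstance
    haveI : IsDominant (Hom.toSchemeHom (baseChangeTowerIso k (↥L') ℂ B₀).hom ≫ πB) := inferInstance
    exact ((Θ₀.pullback_pullback_sameDivisor prB πB₁).trans (Θ₀.pullback_congr_sameDivisor hsq)).trans
      (Θ₀.pullback_pullback_sameDivisor πB _).symm
  -- the complex divisor on `(A₀ ⊗ L′) ⊗ ℂ`: `X_ℂ` vs `λ_ℂ^*((pr_B^*Θ₀)_ℂ)`, same divisor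
  have hsd₁ := pullback_baseChange_sameDivisor ℂ lam πA hπA πB₁ hπB₁ (Θ₀.pullback prB)
  refine ⟨fun j a P Q => ?_, ?_⟩
  · -- (bal)
    have hN0 : ((ℓ ^ j : ℕ) : ℤ) ≠ 0 := by exact_mod_cast pow_ne_zero j hℓ0
    haveI : IsDominant (Hom.toSchemeHom (((ℓ ^ j : ℕ) : ℤ) • 𝟙 ((A₀.baseChange ↥L').baseChange ℂ))) := _hdom j
    haveI : IsDominant (Hom.toSchemeHom (((ℓ ^ j : ℕ) : ℤ) • 𝟙 ((B₀.baseChange ↥L').baseChange ℂ))) :=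
      (isIsogeny_zsmul_id_holds _ _ hN0).isDominant_toSchemeHom
    haveI hdomB : ∀ j : ℕ, IsDominant (Hom.toSchemeHom (((ℓ ^ j : ℕ) : ℤ) • 𝟙 (B₀.baseChange ℂ))) := fun j =>
      (isIsogeny_zsmul_id_holds _ _ (by exact_mod_cast pow_ne_zero j hℓ0)).isDominant_toSchemeHom
    -- (bal) on `(B₀ ⊗ L′) ⊗ ℂ`, from S5b″ through the tower isomorphism
    have hrosB : ∀ (a : 𝓞 K) (P Q : ((B₀.baseChange ↥L').baseChange ℂ).torsionPoints ℂ ((ℓ ^ j : ℕ) : ℤ)),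
        ((B₀.baseChange ↥L').baseChange ℂ).weilPairingLevel ((Θ₀.pullback prB).pullback πB₁)
            ⟨AlgPoints.map ((((B₀.baseChange ↥L').endBaseChange ℂ).comp ((B₀.endBaseChange ↥L').comp ιB)) a).hom.hom.hom P.1,
              map_mem_torsionPoints ((((B₀.baseChange ↥L').endBaseChange ℂ).comp ((B₀.endBaseChange ↥L').comp ιB)) a) P.2⟩
            Q =
          ((B₀.baseChange ↥L').baseChange ℂ).weilPairingLevel ((Θ₀.pullback prB).pullback πB₁) P
            ⟨AlgPoints.map ((((B₀.baseChange ↥L').endBaseChange ℂ).comp ((B₀.endBaseChange ↥L').comp ιB))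
                (IsCMField.ringOfIntegersComplexConj K a)).hom.hom.hom Q.1,
              map_mem_torsionPoints ((((B₀.baseChange ↥L').endBaseChange ℂ).comp ((B₀.endBaseChange ↥L').comp ιB))
                (IsCMField.ringOfIntegersComplexConj K a)) Q.2⟩ := by
      intro a P Q
      rw [weilPairingLevel_congr_sameDivisor hsd₂, weilPairingLevel_congr_sameDivisor hsd₂]
      exact weilPairingLevel_rosatiBalanced_pullback (baseChangeTowerIso k (↥L') ℂ B₀).hom
        (((B₀.baseChange ↥L').endBaseChange ℂ).comp ((B₀.endBaseChange ↥L').comp ιB)) ((B₀.endBaseChange ℂ).comp ιB)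
        (Θ₀.pullback πB) hfT (fun a P Q => hbal₀ πB hπB ℓ hℓ j a P Q) a P Q
    -- transport along `λ ⊗ ℂ`
    rw [weilPairingLevel_congr_sameDivisor hsd₁, weilPairingLevel_congr_sameDivisor hsd₁]
    exact weilPairingLevel_rosatiBalanced_pullback (Hom.baseChange ℂ lam)
      (((A₀.baseChange ↥L').endBaseChange ℂ).comp ((A₀.endBaseChange ↥L').comp ι₀))
      (((B₀.baseChange ↥L').endBaseChange ℂ).comp ((B₀.endBaseChange ↥L').comp ιB)) _ hflam hrosB a P Q
  · -- (nd): `X_ℂ` is ample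
    have hamp : (((Θ₀.pullback prB).pullback (Hom.toSchemeHom lam)).pullback πA).IsAmple := by
      haveI : IsAffineHom prB := by rw [hprB]; exact MorphismProperty.pullback_fst _ _ inferInstance
      haveI : IsFinite (Hom.toSchemeHom lam) := hiso.2
      haveI : IsAffineHom πA := by rw [hπA]; exact MorphismProperty.pullback_fst _ _ inferInstance
      exact ((hΘ₀.pullback prB).pullback (Hom.toSchemeHom lam)).pullback πA
    exact exists_radical_pow_eq_one_of_isAmple _ hamp hℓ (Nat.cast_ne_zero.2 hℓ0)

end Core

/-! ## §3 The assembly: row II-1-S5b from row II-1-S5b″ and the common field of rationality of the pair -/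

section Assembly

/-- **Row II-1-S5b ⟸ row II-1-S5b″ + «one common finite extension over which the homomorphisms of the pair are
rational»** ([Shimura1998] §6.2 Thm. 4 (3) + §12.4 Prop. 26 + §4.1 Prop. 10 give `(B₀, ι_B, Θ₀)` = S5b″ BY NAME; §1.2 /
§18.6 (iv) give the common field `L′` — hypothesis `hpair`, the tree's S9 machinery read for a PAIR of base fields,
discharged in `Motives/AbelianVarietyHomRationalCommonFieldPair`; then §2).  The conclusion is the body of
`exists_balancedDivisor_finiteExtension` VERBATIM (the junction `stub_balancedDivisor` of the h21 workfile consumes it by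
name). [cite: Shimura1998, §6.2 Thm. 4 (3) p. 44; §4.1 Prop. 10 p. 23; §12.4 Prop. 26; §1.2 p. 4; §18.6 proof of Thm. 18.6, condition (iv) on L, p. 127]
[cite: MumfordAV1970, §20 (3) (p. 186), §23 (p. 208)] -/
theorem exists_balancedDivisor_finiteExtension_of_polarisedStructure_of_pair
    (h : exists_balancedPolarisedStructure_numberField)
    (hpair : ∀ {L : Type} [Field L] [NumberField L] [Algebra L ℂ] {k : Type} [Field k] [NumberField k] [Algebra k ℂ]
      (A₀ : AbelianVariety L) (B₀ : AbelianVariety k),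
      ∃ (L' : IntermediateField L ℂ) (_ : FiniteDimensional L ↥L') (i : k →+* ↥L'),
        (algebraMap ↥L' ℂ).comp i = algebraMap k ℂ ∧
        letI : Algebra k ↥L' := i.toAlgebra
        Function.Surjective (Hom.baseChange ℂ : (A₀.baseChange ↥L' ⟶ B₀.baseChange ↥L') →
            ((A₀.baseChange ↥L').baseChange ℂ ⟶ (B₀.baseChange ↥L').baseChange ℂ)) ∧
          Function.Surjective (Hom.baseChange ℂ : (B₀.baseChange ↥L' ⟶ A₀.baseChange ↥L') →
            ((B₀.baseChange ↥L').baseChange ℂ ⟶ (A₀.baseChange ↥L').baseChange ℂ))) :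
    exists_balancedDivisor_finiteExtension := by
  intro K _ _ _ Φ L _ _ _ A₀ ι₀ hA₀
  obtain ⟨k, _, _, _, B₀, ιB, hB₀, Θ₀, hΘ₀, hbal₀⟩ := h K Φ
  obtain ⟨L', hfd, i, hi, hsurj⟩ := hpair A₀ B₀
  letI : Algebra k ↥L' := i.toAlgebra
  obtain ⟨hAB, hBA⟩ := hsurj
  haveI : IsScalarTower k ↥L' ℂ :=
    IsScalarTower.of_algebraMap_eq fun x => (RingHom.congr_fun hi x).symm
  obtain ⟨X, hX⟩ := exists_balancedDivisor_of_polarisedModel hA₀ hB₀ Θ₀ hΘ₀ hbal₀ L' hAB hBA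
  exact ⟨L', hfd, X, hX⟩

end Assembly

end Literature.NumberTheory.ComplexMultiplication

end
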